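import Literature.AlgebraicGeometry.Smoothening.DilatationDefectDrop
import Mathlib.RingTheory.Polynomial.Basic
import HarnessLib

/-!
# Packaging the equations of `X` for the defect drop: once- and twice-divided generators

Topic: `Literature/AlgebraicGeometry/Smoothening` (Bosch–Lütkebohmert–Raynaud, *Néron Models*,
§3.3, proof of Prop. 5). `DilatationDefectDrop.neronDefect_dilatation_add_le_of_centre` bounds
Néron's measure on the dilatation in terms of *generator data* for the ideal `I` of
`X ⊂ 𝔸ᴺ_R`: `p` equations `Fᵢ = ϖ f₀ᵢ + Σ gⱼ fᵢⱼ` and finitely many `Q_k ∈ (ϖ, g)²`, written out as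
`ϖ² q₀₀ + ϖ Σ gⱼ q₀ⱼ + Σ gⱼ gₗ qⱼₗ`, generating `I`. This file produces the second half of the data
from the natural hypotheses of the smoothening process (`B` Noetherian; all generation
statements up to a multiplicative set `U` of elements invertible at the point):

* the `Fᵢ` generate `I` *modulo the equations with vanishing linear part along the centre*,
  `I ⊆ (F₁, …, F_p) + (ϖ) + (ϖ, g)·(g)` (`hgen₁`; this is what the choice of `p = N - q`
  equations with independent linear parts gives, BLR Lemma 3.3/4), and
* **density**: `A/𝔟 → A[𝔟/ϖ]/(ϖ)` is injective (the exceptional fibre is schematically dense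
  over the centre), which by `mem_centreIdealB_of_injective_dilatation` upgrades
  "vanishing linear part" to "lies in `(ϖ, g)²`" (Artin (3.12)).

Then `I = (F) + I ∩ (ϖ, g)²`, the Noetherian ideal `I ∩ (ϖ, g)²` has finitely many generators,
and each element of `(ϖ, g)² = (ϖ², ϖ gⱼ, gⱼ gₗ)` has the required shape
(`exists_twiceDivided_of_mem_sq`). The resulting form of BLR Prop. 3.3/5 is
`neronDefect_dilatation_add_le_of_density`. [folklore] packaging; no named facts (D-0026).

## References

* S. Bosch, W. Lütkebohmert, M. Raynaud, *Néron Models*, Springer 1990, §3.3, Lemma 4,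
  Prop. 5. [BLRNeronModels1990] (Not held; numbers only.)
* M. Artin, *Néron Models*, in: G. Cornell, J. H. Silverman (eds.), *Arithmetic Geometry*,
  Springer 1986, proof of Lemma (3.9), (3.11)–(3.12) (p. 227). [Artin1986NeronModels]
-/

noncomputable section

open scoped TensorProduct
open MvPolynomial Literature.AlgebraicGeometry.Dilatations

namespace Literature.AlgebraicGeometry.Smoothening

universe u

section Ideals

variable {R : Type u} [CommRing R] (ϖ : R) {B : Type u} [CommRing B] [Algebra R B] (I : Ideal B)
  {r : ℕ} (g : Fin r → B)

/-- The generators `ϖ, g₁, …, g_r` of `𝔟̃` as one family indexed by `Option (Fin r)`. [folklore] -/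
def centreGen : Option (Fin r) → B
  | none => algebraMap R B ϖ
  | some j => g j

/-- The family `centreGen` enumerates `{ϖ, g₁, …, g_r}`. [folklore] -/
theorem range_centreGen : Set.range (centreGen ϖ g) = insert (algebraMap R B ϖ) (Set.range g) := by
  ext x
  simp only [Set.mem_range, Set.mem_insert_iff]
  constructor
  · rintro ⟨_ | j, rfl⟩
    · exact Or.inl rfl
    · exact Or.inr ⟨j, rfl⟩
  · rintro (rfl | ⟨j, rfl⟩)
    · exact ⟨none, rfl⟩
    · exact ⟨some j, rfl⟩

/-- `𝔟̃ = span (ϖ, g)`. [folklore] -/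
theorem centreIdealB_eq_span : centreIdealB ϖ g = Ideal.span (Set.range (centreGen ϖ g)) := by
  rw [range_centreGen]
  rfl

/-- `𝔟̃² = span (ϖ², ϖ gⱼ, gⱼ ϖ, gⱼ gₗ)`. [folklore] -/
theorem centreIdealB_sq_eq_span :
    centreIdealB ϖ g ^ 2 =
      Ideal.span (Set.range fun uv : Option (Fin r) × Option (Fin r) =>
        centreGen ϖ g uv.1 * centreGen ϖ g uv.2) := by
  rw [sq, centreIdealB_eq_span, Ideal.span_mul_span']
  congr 1
  ext x
  simp only [Set.mem_mul, Set.mem_range, Prod.exists]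
  constructor
  · rintro ⟨_, ⟨u, rfl⟩, _, ⟨v, rfl⟩, rfl⟩
    exact ⟨u, v, rfl⟩
  · rintro ⟨u, v, rfl⟩
    exact ⟨_, ⟨u, rfl⟩, _, ⟨v, rfl⟩, rfl⟩

/-- **Every element of `(ϖ, g)²` has the shape `ϖ² q₀₀ + Σ ϖ gⱼ q₀ⱼ + Σ gⱼ gₗ qⱼₗ`.** [folklore] -/
theorem exists_twiceDivided_of_mem_sq {Q : B} (hQ : Q ∈ centreIdealB ϖ g ^ 2) :
    ∃ (q00 : B) (q0 : Fin r → B)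
      (qq : Fin r → Fin r → B),
      Q = algebraMap R B ϖ * algebraMap R B ϖ * q00 + ∑ j, algebraMap R B ϖ * g j * q0 j + ∑ j, ∑ l, g j * g l * qq j l := by
  classical
  rw [centreIdealB_sq_eq_span] at hQ
  obtain ⟨c, rfl⟩ := (Ideal.mem_span_range_iff_exists_fun).mp hQ
  refine ⟨c (none, none), fun j => c (none, some j) + c (some j, none),
    fun j l => c (some j, some l), ?_⟩
  rw [Fintype.sum_prod_type, Fintype.sum_option]
  simp only [Fintype.sum_option, centreGen]
  simp only [mul_add, Finset.sum_add_distrib]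
  have e1 : ∀ j, c (none, some j) * (algebraMap R B ϖ * g j) = algebraMap R B ϖ * g j * c (none, some j) := fun j => by ring
  have e2 : ∀ j, c (some j, none) * (g j * algebraMap R B ϖ) = algebraMap R B ϖ * g j * c (some j, none) := fun j => by ring
  have e3 : ∀ j l, c (some j, some l) * (g j * g l) = g j * g l * c (some j, some l) :=
    fun j l => by ring
  simp only [e1, e2, e3]
  ring

/-- The equations with vanishing linear part along the centre: the ideal `(ϖ) + 𝔟̃·(g)`.
[folklore] -/
def vanishingLinearPart : Ideal (B) :=
  Ideal.span {algebraMap R B ϖ} ⊔ centreIdealB ϖ g * Ideal.span (Set.range g)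

/-- Elements of `(ϖ) + 𝔟̃·(g)` have the shape `ϖ e₀ + Σ gⱼ yⱼ` with `yⱼ ∈ 𝔟̃`. [folklore] -/
theorem exists_of_mem_vanishingLinearPart {e : B}
    (he : e ∈ vanishingLinearPart ϖ g) :
    ∃ (e0 : B) (y : Fin r → B),
      (∀ j, y j ∈ centreIdealB ϖ g) ∧ e = algebraMap R B ϖ * e0 + ∑ j, g j * y j := by
  classical
  obtain ⟨e₁, he₁, e₂, he₂, rfl⟩ := Submodule.mem_sup.mp he
  obtain ⟨e0, rfl⟩ := Ideal.mem_span_singleton'.mp he₁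
  rw [← Ideal.smul_eq_mul, ← Ideal.submodule_span_eq] at he₂
  obtain ⟨a, ha, rfl⟩ := (Submodule.mem_ideal_smul_span_iff_exists_sum (centreIdealB ϖ g) g e₂).mp he₂
  refine ⟨e0, fun j => a j, fun j => ha j, ?_⟩
  rw [mul_comm, Finsupp.sum_fintype _ _ (fun j => by simp)]
  congr 1
  exact Finset.sum_congr rfl fun j _ => by rw [smul_eq_mul, mul_comm]

/-- `(ϖ) + 𝔟̃·(g) ⊆ 𝔟̃`. [folklore] -/
theorem vanishingLinearPart_le : vanishingLinearPart ϖ g ≤ centreIdealB ϖ g := by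
  refine sup_le ?_ Ideal.mul_le_right
  rw [Ideal.span_singleton_le_iff_mem]
  exact Ideal.subset_span (Set.mem_insert _ _)

end Ideals

/-! ### The data from density -/

section Density

variable {R : Type u} [CommRing R] (ϖ : R) {B : Type u} [CommRing B] [Algebra R B]
  [IsNoetherianRing B] (I : Ideal B) {r : ℕ} (g : Fin r → B)

/-- **Packaging.** If `I ⊆ (F) + ((ϖ) + 𝔟̃·(g))` for equations `F₁, …, F_p ∈ I` and every
equation of `I` with vanishing linear part lies in `𝔟̃²` (density), then there are finitely many
`Q_k = ϖ² q₀₀ + ϖ Σ gⱼ q₀ⱼ + Σ gⱼ gₗ qⱼₗ ∈ I` with `I ⊆ (F) + (Q)` (`R` Noetherian). [folklore] -/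
theorem exists_twiceDivided_generators {p : ℕ} (F : Fin p → B)
    (hF : ∀ i, F i ∈ I) (U : Submonoid B)
    (hgen₁ : ∀ f ∈ I, ∃ u ∈ U, u * f ∈ Ideal.span (Set.range F) ⊔ vanishingLinearPart ϖ g)
    (hden : ∀ (e0 : B) (y : Fin r → B),
      (∀ j, y j ∈ centreIdealB ϖ g) → algebraMap R B ϖ * e0 + ∑ j, g j * y j ∈ I → e0 ∈ centreIdealB ϖ g) :
    ∃ (m : ℕ) (q00 : Fin m → B) (q0 : Fin m → Fin r → B)
      (qq : Fin m → Fin r → Fin r → B),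
      (∀ k, algebraMap R B ϖ * algebraMap R B ϖ * q00 k + ∑ j, algebraMap R B ϖ * g j * q0 k j + ∑ j, ∑ l, g j * g l * qq k j l ∈ I) ∧
      ∀ f ∈ I, ∃ u ∈ U, u * f ∈ Ideal.span (Set.range F) ⊔ Ideal.span (Set.range fun k =>
        algebraMap R B ϖ * algebraMap R B ϖ * q00 k + ∑ j, algebraMap R B ϖ * g j * q0 k j + ∑ j, ∑ l, g j * g l * qq k j l) := by
  classical
  -- `I ∩ 𝔟̃²` is finitely generated
  obtain ⟨s, hs⟩ := (isNoetherian_def.mp inferInstance) (I ⊓ centreIdealB ϖ g ^ 2)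
  -- enumerate and decompose the generators
  let Q : Fin s.card → B := fun k => (s.equivFin.symm k : B)
  have hQrange : Set.range Q = (s : Set B) := by
    ext x
    simp only [Set.mem_range, Finset.mem_coe, Q]
    constructor
    · rintro ⟨k, rfl⟩
      exact (s.equivFin.symm k).2
    · intro hx
      exact ⟨s.equivFin ⟨x, hx⟩, by simp⟩
  have hQmem : ∀ k, Q k ∈ I ⊓ centreIdealB ϖ g ^ 2 := fun k => by
    rw [← hs]
    exact Ideal.subset_span (s.equivFin.symm k).2
  have hdec : ∀ k, ∃ (q00 : B) (q0 : Fin r → B)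
      (qq : Fin r → Fin r → B),
      Q k = algebraMap R B ϖ * algebraMap R B ϖ * q00 + ∑ j, algebraMap R B ϖ * g j * q0 j + ∑ j, ∑ l, g j * g l * qq j l :=
    fun k => exists_twiceDivided_of_mem_sq ϖ g (hQmem k).2
  choose q00 q0 qq hQ using hdec
  have hQfun : (fun k => algebraMap R B ϖ * algebraMap R B ϖ * q00 k + ∑ j, algebraMap R B ϖ * g j * q0 k j +
      ∑ j, ∑ l, g j * g l * qq k j l) = Q := funext fun k => (hQ k).symm
  refine ⟨s.card, q00, q0, qq, fun k => (hQ k) ▸ (hQmem k).1, ?_⟩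
  rw [hQfun, hQrange, show Ideal.span (s : Set B) = I ⊓ centreIdealB ϖ g ^ 2
    from hs]
  -- `u f ∈ (F) + I ∩ 𝔟̃²`
  intro f hf
  obtain ⟨u, hu, huf⟩ := hgen₁ f hf
  refine ⟨u, hu, ?_⟩
  obtain ⟨f₁, hf₁, e, he, hsum⟩ := Submodule.mem_sup.mp huf
  have hFI : Ideal.span (Set.range F) ≤ I := Ideal.span_le.mpr (by rintro _ ⟨i, rfl⟩; exact hF i)
  have heI : e ∈ I := by
    have : f₁ + e - f₁ ∈ I := I.sub_mem (hsum ▸ I.mul_mem_left u hf) (hFI hf₁)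
    simpa using this
  obtain ⟨e0, y, hy, rfl⟩ := exists_of_mem_vanishingLinearPart ϖ g he
  have he0 : e0 ∈ centreIdealB ϖ g := hden e0 y hy heI
  have hesq : algebraMap R B ϖ * e0 + ∑ j, g j * y j ∈ centreIdealB ϖ g ^ 2 := by
    rw [sq]
    refine add_mem (Ideal.mul_mem_mul (Ideal.subset_span (Set.mem_insert _ _)) he0)
      (Ideal.sum_mem _ fun j _ => Ideal.mul_mem_mul
        (Ideal.subset_span (Set.mem_insert_of_mem _ ⟨j, rfl⟩)) (hy j))
  rw [← hsum]
  exact Submodule.mem_sup.mpr ⟨f₁, hf₁, _, ⟨heI, hesq⟩, rfl⟩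

end Density

/-! ### BLR Prop. 3.3/5 from density -/

section Combined

variable {R : Type u} [CommRing R] (ϖ : R) {B : Type u} [CommRing B] [Algebra R B]
  [IsNoetherianRing B] (I : Ideal B) {r : ℕ} (g : Fin r → B)
  (S : Type u) [CommRing S] [IsDomain S] [IsDiscreteValuationRing S] [Algebra R S]
  [Algebra B S] [Algebra (B ⧸ I) S]
  [Algebra (dilatation ϖ (centreIdeal ϖ I g)) S]
  [IsScalarTower R B S]
  [IsScalarTower B (B ⧸ I) S]
  [IsScalarTower R (B ⧸ I) S]
  [IsScalarTower (B ⧸ I) (dilatation ϖ (centreIdeal ϖ I g)) S]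
  [IsScalarTower R (dilatation ϖ (centreIdeal ϖ I g)) S]

/-- **BLR Prop. 3.3/5 for the affine dilatation, from density** (pointwise): let
`X = Spec R[T₁, …, T_N]/I` with `I ⊆ 𝔟̃ = (ϖ, g₁, …, g_r)` (the centre `V(𝔟̃) ⊆ X_k`),
`X' = Spec A[𝔟/ϖ]` its dilatation, `a, a'` compatible points with values in a discrete valuation
ring `S` in which `ϖ` is a uniformizer, such that: the residues of the `dgⱼ(a)` are independent
(the centre is smooth at the point), `A/𝔟 → A[𝔟/ϖ]/(ϖ)` is injective (density), and `I` is
generated by `p` equations `Fᵢ = ϖ f₀ᵢ + Σ gⱼ fᵢⱼ` modulo `(ϖ) + 𝔟̃·(g)`. Then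
`δ(a') + N ≤ δ(a) + p + rank_S a*Ω¹_{X/R}`; with `p = N - q` (`q` the fibre dimension) and
`q ≥ rank + 1` at a non-smooth point (`FibreDimension`), `δ(a') ≤ δ(a) - 1`.
[cite: Artin1986NeronModels, Lemma (3.9) (p. 227)] -/
theorem neronDefect_dilatation_add_finrank_le_of_density [Module.Free B Ω[B⁄R]]
    [Module.Finite B Ω[B⁄R]] (hπ : Irreducible (algebraMap R S ϖ))
    (hγ : ∀ c : Fin r → S,
      (∃ y : S ⊗[B] Ω[B⁄R],
        ∑ j, c j • centreVec S g j = algebraMap R S ϖ • y) → ∀ j, algebraMap R S ϖ ∣ c j)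
    (hinj : Function.Injective (Ideal.quotientMap
      (Ideal.span {algebraMap R (dilatation ϖ (centreIdeal ϖ I g)) ϖ})
      (algebraMap (B ⧸ I) (dilatation ϖ (centreIdeal ϖ I g)))
      (Ideal.map_le_iff_le_comap.mp (map_centreIdeal_dilatation_le ϖ I g))))
    (hI : I ≤ centreIdealB ϖ g)
    {p : ℕ} (f0 : Fin p → B) (fc : Fin p → Fin r → B)
    (hf : ∀ i, algebraMap R B ϖ * f0 i + ∑ j, g j * fc i j ∈ I)
    (U : Submonoid B) (hU : ∀ u ∈ U, IsUnit (algebraMap B S u))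
    (hgen₁ : ∀ f ∈ I, ∃ u ∈ U, u * f ∈
      Ideal.span (Set.range fun i => algebraMap R B ϖ * f0 i + ∑ j, g j * fc i j) ⊔
        vanishingLinearPart ϖ g) :
    neronDefect R (dilatation ϖ (centreIdeal ϖ I g)) S + Module.finrank B Ω[B⁄R] ≤
      neronDefect R (B ⧸ I) S + p +
        Module.finrank S (S ⊗[B ⧸ I] Ω[(B ⧸ I)⁄R]) := by
  have hden : ∀ (e0 : B) (y : Fin r → B),
      (∀ j, y j ∈ centreIdealB ϖ g) → algebraMap R B ϖ * e0 + ∑ j, g j * y j ∈ I →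
        e0 ∈ centreIdealB ϖ g :=
    fun e0 y hy h => mem_centreIdealB_of_injective_dilatation ϖ I g hinj hI hy h
  obtain ⟨m, q00, q0, qq, hq, hgen⟩ :=
    exists_twiceDivided_generators ϖ I g (fun i => algebraMap R B ϖ * f0 i + ∑ j, g j * fc i j) hf
      U hgen₁ hden
  exact neronDefect_dilatation_add_finrank_le_of_centre ϖ I g S hπ hγ f0 fc hf q00 q0 qq hq U hU hgen

end Combined

/-! ### The polynomial case -/

section MvPolynomialCase

variable {R : Type u} [CommRing R] [IsNoetherianRing R] (ϖ : R) {N : ℕ}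
  (I : Ideal (MvPolynomial (Fin N) R)) {r : ℕ} (g : Fin r → MvPolynomial (Fin N) R)
  (S : Type u) [CommRing S] [IsDomain S] [IsDiscreteValuationRing S] [Algebra R S]
  [Algebra (MvPolynomial (Fin N) R) S] [Algebra (MvPolynomial (Fin N) R ⧸ I) S]
  [Algebra (dilatation ϖ (centreIdeal ϖ I g)) S]
  [IsScalarTower R (MvPolynomial (Fin N) R) S]
  [IsScalarTower (MvPolynomial (Fin N) R) (MvPolynomial (Fin N) R ⧸ I) S]
  [IsScalarTower R (MvPolynomial (Fin N) R ⧸ I) S]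
  [IsScalarTower (MvPolynomial (Fin N) R ⧸ I) (dilatation ϖ (centreIdeal ϖ I g)) S]
  [IsScalarTower R (dilatation ϖ (centreIdeal ϖ I g)) S]

/-- **BLR Prop. 3.3/5 for the affine dilatation, from density** (pointwise): let
`X = Spec R[T₁, …, T_N]/I` with `I ⊆ 𝔟̃ = (ϖ, g₁, …, g_r)` (the centre `V(𝔟̃) ⊆ X_k`),
`X' = Spec A[𝔟/ϖ]` its dilatation, `a, a'` compatible points with values in a discrete valuation
ring `S` in which `ϖ` is a uniformizer, such that: the residues of the `dgⱼ(a)` are independent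
(the centre is smooth at the point), `A/𝔟 → A[𝔟/ϖ]/(ϖ)` is injective (density), and `I` is
generated by `p` equations `Fᵢ = ϖ f₀ᵢ + Σ gⱼ fᵢⱼ` modulo `(ϖ) + 𝔟̃·(g)`. Then
`δ(a') + N ≤ δ(a) + p + rank_S a*Ω¹_{X/R}`; with `p = N - q` (`q` the fibre dimension) and
`q ≥ rank + 1` at a non-smooth point (`FibreDimension`), `δ(a') ≤ δ(a) - 1`.
[cite: Artin1986NeronModels, Lemma (3.9) (p. 227)] -/
theorem neronDefect_dilatation_add_le_of_density (hπ : Irreducible (algebraMap R S ϖ))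
    (hγ : ∀ c : Fin r → S,
      (∃ y : S ⊗[MvPolynomial (Fin N) R] Ω[MvPolynomial (Fin N) R⁄R],
        ∑ j, c j • centreVec S g j = algebraMap R S ϖ • y) → ∀ j, algebraMap R S ϖ ∣ c j)
    (hinj : Function.Injective (Ideal.quotientMap
      (Ideal.span {algebraMap R (dilatation ϖ (centreIdeal ϖ I g)) ϖ})
      (algebraMap (MvPolynomial (Fin N) R ⧸ I) (dilatation ϖ (centreIdeal ϖ I g)))
      (Ideal.map_le_iff_le_comap.mp (map_centreIdeal_dilatation_le ϖ I g))))
    (hI : I ≤ centreIdealB ϖ g)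
    {p : ℕ} (f0 : Fin p → MvPolynomial (Fin N) R) (fc : Fin p → Fin r → MvPolynomial (Fin N) R)
    (hf : ∀ i, C ϖ * f0 i + ∑ j, g j * fc i j ∈ I)
    (hgen₁ : I ≤ Ideal.span (Set.range fun i => C ϖ * f0 i + ∑ j, g j * fc i j) ⊔
      vanishingLinearPart ϖ g) :
    neronDefect R (dilatation ϖ (centreIdeal ϖ I g)) S + N ≤
      neronDefect R (MvPolynomial (Fin N) R ⧸ I) S + p +
        Module.finrank S (S ⊗[MvPolynomial (Fin N) R ⧸ I] Ω[(MvPolynomial (Fin N) R ⧸ I)⁄R]) := by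
  haveI : Nontrivial R := (algebraMap R S).domain_nontrivial
  haveI : Module.Free (MvPolynomial (Fin N) R) Ω[MvPolynomial (Fin N) R⁄R] :=
    Module.Free.of_basis (KaehlerDifferential.mvPolynomialBasis R (Fin N))
  have hNf : Module.finrank (MvPolynomial (Fin N) R) Ω[MvPolynomial (Fin N) R⁄R] = N := by
    rw [Module.finrank_eq_card_basis (KaehlerDifferential.mvPolynomialBasis R (Fin N)),
      Fintype.card_fin]
  have h := neronDefect_dilatation_add_finrank_le_of_density ϖ I g S hπ hγ hinj hI f0 fc hf ⊥
    (fun u hu => by rw [Submonoid.mem_bot] at hu; rw [hu, map_one]; exact isUnit_one)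
    (fun f hf' => ⟨1, Submonoid.one_mem _, by rw [one_mul]; exact hgen₁ hf'⟩)
  rwa [hNf] at h

end MvPolynomialCase

end Literature.AlgebraicGeometry.Smoothening
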